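import Literature.Geometry.Kaehler.ComplexTorusWeilOperatorWeylOperator
import Literature.LinearAlgebra.FiniteOrderOperatorEigenprojectors
import HarnessLib

/-!
# The spectra of the Weyl operator `w` and of the Weil operator `C` on `H•(X; ℂ)` of a polarised complex torus of dimension `g`:
# both are diagonalizable with eigenvalues `1, −1, i, −i` of multiplicities `4^{g−1} + 2^{g−1}`, `4^{g−1} − 2^{g−1}`, `4^{g−1}`, `4^{g−1}`

Layer `Literature/Geometry/Kaehler`, namespace `Literature.Geometry.Kaehler.ComplexTorus`; lane `lit-hodgefound` (Track 2 foundations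
library), prover seat `lit-hodgefound-p09` (generation 54, row g54-#4).  THEOREMS ONLY (no definition, no named fact, no instance, no
notation; D-0026 net debt `0`).  Sequel of rows g54-#1 `LinearAlgebra/FiniteOrderOperatorEigenprojectors` (Serre's canonical decomposition
for a finite-order operator `T^n = 1`: **`natCast_mul_finrank_eigenspace_eq_sum_trace_pow`** `n · dim ker(T − μ) = Σ_{k<n} μ^{−k} tr(T^k)`,
`iSup_eigenspace_pow_eq_top`, `isInternal_eigenspace_pow`) and g54-#2 `ComplexTorusWeilOperatorWeylOperator` (the traces of the powers:
`tr 1 = 4^g`, `tr w = tr w³ = tr C = tr C³ = 2^g`, `tr w² = tr C² = 0`; `C⁴ = 1`), with g53-#7 (`trace_weylOperator`), g53-#10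
(`trace_rotG_pi_div_two`) and p34's `weylOperator_pow_four` (`w⁴ = 1`), all BY NAME.

THE RESULT.  On the `4^g`-dimensional space `H•(X; ℂ)` of a complex torus `X` of dimension `g ≥ 1` the Weyl element `w = ρ(0 −1 ; 1 0)` of
Beauville's `SL₂`-action (defined by any non-degenerate real `2`-form `η`) and the Weil operator `C = (i·)^*` of the complex structure are
two commuting operators of order `4`.  Serre's multiplicity formula for the cyclic group `C₄` (`4 · dim ker(T − i^j) = Σ_{k<4} i^{−jk} tr T^k`)
and the traces of their powers — which COINCIDE — show that they have THE SAME SPECTRUM: eigenvalue `1` with multiplicity `4^{g−1} + 2^{g−1}`,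
`−1` with multiplicity `4^{g−1} − 2^{g−1}`, and `±i` with multiplicity `4^{g−1}` each; and `H•(X; ℂ)` is the direct sum of the four
eigenspaces of either.  (For `C` these are the sums of the Hodge numbers `h^{p,q} = C(g,p)C(g,q)` over `p − q` in a fixed class mod `4`; for
`w` the count is new: e.g. for an elliptic curve `w` has eigenvalues `1, 1, i, −i` on `H⁰ ⊕ H² ⊕ H¹`, for an abelian surface `1⁶, (−1)², i⁴,
(−i)⁴`.)

## What is proved (`g = dim_ℂ E`, `w = (hasLefschetzProperty_lefschetzG hη).weylOperator isZGrading_countingG`, `C = rotG E (π/2)`)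

* §0 for any operator `T` of order `4` on `H•(X; ℂ)` with `tr T = tr T³ = 2^g`, `tr T² = 0`: `four_mul_finrank_eigenspace_eq_of_traces`
  (`4 · dim ker(T − μ) = 4^g + (μ⁻¹ + μ^{−3}) 2^g`), `finrank_eigenspace_one_eq_of_traces` (`4^{g−1} + 2^{g−1}`), `…_neg_one_…` (`4^{g−1} − 2^{g−1}`),
  `…_I_…`, `…_neg_I_…` (`4^{g−1}`).
* §1 THE WEYL OPERATOR: `four_mul_finrank_eigenspace_weylOperator_eq` (`4 · dim ker(w − μ) = 4^g + (μ⁻¹ + μ^{−3}) 2^g` for `μ⁴ = 1`),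
  **`finrank_eigenspace_weylOperator_one`** (`dim ker(w − 1) = 4^{g−1} + 2^{g−1}`), **`finrank_eigenspace_weylOperator_neg_one`**
  (`= 4^{g−1} − 2^{g−1}`), **`finrank_eigenspace_weylOperator_I`**, **`finrank_eigenspace_weylOperator_neg_I`** (`= 4^{g−1}`);
  `iSup_eigenspace_weylOperator_eq_top`, **`isInternal_eigenspace_weylOperator`** (`H•(X; ℂ) = ⊕_{j<4} ker(w − i^j)`: `w` is diagonalizable).
* §2 THE WEIL OPERATOR (no `η` needed): the same statements for `C` (`four_mul_finrank_eigenspace_rotG_pi_div_two_eq`,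
  `finrank_eigenspace_rotG_pi_div_two_one` ∕ `_neg_one` ∕ `_I` ∕ `_neg_I`, `iSup_eigenspace_rotG_pi_div_two_eq_top`, `isInternal_eigenspace_rotG_pi_div_two`),
  and **`finrank_eigenspace_weylOperator_eq_finrank_eigenspace_rotG_pi_div_two`**: `w` and `C` have the same multiplicity at every fourth
  root of unity.

## Sources, VERBATIM

* J.-P. Serre, *Linear Representations of Finite Groups* (1977) [Serre1977] (held `book:serre1977-linear-representations-finite-groups`), §2.6
  Thm. 8 (ii) (p0024): "`p_i = (n_i/g) Σ_{t∈G} χ_i(t)^* ρ_t`"; §5.1 (p0035): "`χ_h(r^k) = e^{2πihk/n}`"; §2.6 Ex. 2.8 (a): "the number of times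
  that `W_i` appears in `V`".
* A. Beauville, *The action of SL₂ on abelian varieties* (2010) [Beauville2010SL2] (held `paper:arxiv-0805.1541`), §3 Proposition (ii) (p0003):
  "`h² = (β(u)h)³ = β(−I)`" (`w² = (−1)ʰ`, `w⁴ = 1`); §4 Theorem (p0005): "`(0 −1 ; 1 0)·z = ℱ(z)`".
* P. Deligne (J. Milne), *Hodge cycles on abelian varieties*, LNM 900 (1982) [Deligne1982HodgeCycles], I Prop. 3.6 (proof): "write `C = h(i)` […]
  `Cv^{p,q} = i^{−p+q}v^{p,q}`, and so `C²` acts as `(−1)ⁿ` on `V`".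
* H. Lange, *Abelian Varieties over the Complex Numbers* (2023) [Lange2023AbelianVarietiesComplex], §1.1.3 Cor. 1.1.19 (`dim H•(X) = 2^{2g}`),
  §1.1.5 Prop. 1.1.23 (`h^{p,q} = C(g,p) C(g,q)`).

## Scope

Forms carrier only; `η` any non-degenerate real `2`-form for `w` (no type or positivity condition), none for `C`.  The simultaneous
eigenspace decomposition under the commuting pair `(C, w)` (for `η` of type `(1,1)`) is not computed here.
-/

noncomputable section

-- `Module ℂ` / `SMulZeroClass ℂ` synthesis on `E [⋀^Fin k]→L[ℝ] ℂ` (as in `ComplexTorusLefschetzDecomposition`)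
set_option maxSynthPendingDepth 3

namespace Literature.Geometry.Kaehler

namespace ComplexTorus

-- `_root_.Complex`: the import closure declares a namespace `…ComplexTorus.Complex`; be explicit.
open Module Function Finset _root_.Complex
open scoped Real
open Literature.LinearAlgebra Literature.LinearAlgebra.Alternating Literature.Algebra.Lie Literature.Analysis.Complex

universe uE

variable {E : Type uE} [NormedAddCommGroup E] [NormedSpace ℂ E] [FiniteDimensional ℂ E] [Nontrivial E] {η : E [⋀^Fin 2]→L[ℝ] ℝ}

/-! ## §0 Arithmetic of the fourth roots of unity -/

omit [FiniteDimensional ℂ E] [Nontrivial E] in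
/-- `i` is a primitive fourth root of unity. [cite: Serre1977, §5.1] -/
private theorem isPrimitiveRoot_I_four₉₄ : IsPrimitiveRoot I 4 := by
  have h := Complex.isPrimitiveRoot_exp 4 (by norm_num)
  have e : cexp (2 * π * I / (4 : ℕ)) = I := by
    rw [show (2 * π * I / (4 : ℕ) : ℂ) = (π / 2 : ℂ) * I by push_cast; ring, Complex.exp_mul_I,
      show (π / 2 : ℂ) = ((π / 2 : ℝ) : ℂ) by push_cast; ring, ← Complex.ofReal_cos, ← Complex.ofReal_sin, Real.cos_pi_div_two,
      Real.sin_pi_div_two]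
    simp
  rwa [e] at h

omit [FiniteDimensional ℂ E] [Nontrivial E] in
/-- `(4 : ℂ) ≠ 0`. [folklore] -/
private theorem four_ne_zero₉₄ : ((4 : ℕ) : ℂ) ≠ 0 := by norm_num

/-- `4^g = 4 · 4^{g−1}` and `2^g + 2^g = 4 · 2^{g−1}` for `g = dim_ℂ E ≥ 1`. [folklore] -/
private theorem four_pow_finrank₉₄ : (4 : ℂ) ^ finrank ℂ E = 4 * 4 ^ (finrank ℂ E - 1) ∧ (2 : ℂ) ^ finrank ℂ E + 2 ^ finrank ℂ E =
    4 * 2 ^ (finrank ℂ E - 1) := by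
  obtain ⟨m, hm⟩ : ∃ m, finrank ℂ E = m + 1 := ⟨finrank ℂ E - 1, by have := finrank_pos (R := ℂ) (M := E); omega⟩
  rw [hm, Nat.add_sub_cancel, pow_succ', pow_succ']
  constructor
  · rfl
  · ring

omit [Nontrivial E] in
/-- **THE MULTIPLICITY SUM FOR AN OPERATOR OF ORDER `4` WITH THE TRACES OF `w` ∕ `C`**: if `T⁴ = 1` on `H•(X; ℂ)`, `tr T = tr T³ = 2^g` and
`tr T² = 0`, then `4 · dim ker(T − μ) = 4^g + (μ⁻¹ + μ^{−3}) 2^g` for every `μ` with `μ⁴ = 1` (Serre's `Σ_{k<4} μ^{−k} tr T^k`).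
[cite: Serre1977, §2.6 Thm. 8 (ii), Ex. 2.8 (a) and §5.1] -/
theorem four_mul_finrank_eigenspace_eq_of_traces {T : Module.End ℂ (GForm E ℂ)} (hT : T ^ 4 = 1)
    (h1 : LinearMap.trace ℂ (GForm E ℂ) T = (2 : ℂ) ^ finrank ℂ E) (h2 : LinearMap.trace ℂ (GForm E ℂ) (T ^ 2) = 0)
    (h3 : LinearMap.trace ℂ (GForm E ℂ) (T ^ 3) = (2 : ℂ) ^ finrank ℂ E) {μ : ℂ} (hμ : μ ^ 4 = 1) :
    (4 : ℂ) * (finrank ℂ ↥(Module.End.eigenspace T μ) : ℂ) = 4 ^ finrank ℂ E + (μ⁻¹ + μ⁻¹ ^ 3) * 2 ^ finrank ℂ E := by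
  have h := natCast_mul_finrank_eigenspace_eq_sum_trace_pow T four_ne_zero₉₄ hT hμ
  rw [Nat.cast_ofNat] at h
  rw [h, Finset.sum_range_succ, Finset.sum_range_succ, Finset.sum_range_succ, Finset.sum_range_succ, Finset.sum_range_zero, pow_zero,
    pow_zero, trace_one_gForm, pow_one, pow_one, h1, h2, h3]
  ring

/-- `dim ker(T − 1) = 4^{g−1} + 2^{g−1}` under the hypotheses of `four_mul_finrank_eigenspace_eq_of_traces`. [cite: Serre1977, §2.6 Thm. 8 (ii) and §5.1] -/
theorem finrank_eigenspace_one_eq_of_traces {T : Module.End ℂ (GForm E ℂ)} (hT : T ^ 4 = 1)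
    (h1 : LinearMap.trace ℂ (GForm E ℂ) T = (2 : ℂ) ^ finrank ℂ E) (h2 : LinearMap.trace ℂ (GForm E ℂ) (T ^ 2) = 0)
    (h3 : LinearMap.trace ℂ (GForm E ℂ) (T ^ 3) = (2 : ℂ) ^ finrank ℂ E) :
    finrank ℂ ↥(Module.End.eigenspace T 1) = 4 ^ (finrank ℂ E - 1) + 2 ^ (finrank ℂ E - 1) := by
  have h := four_mul_finrank_eigenspace_eq_of_traces hT h1 h2 h3 (μ := 1) (one_pow 4)
  obtain ⟨h4, h2'⟩ := four_pow_finrank₉₄ (E := E)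
  rw [inv_one, one_pow, show ((1 : ℂ) + 1) * 2 ^ finrank ℂ E = 2 ^ finrank ℂ E + 2 ^ finrank ℂ E by ring, h4, h2', ← mul_add] at h
  exact_mod_cast mul_left_cancel₀ (by norm_num : (4 : ℂ) ≠ 0) h

/-- `dim ker(T + 1) = 4^{g−1} − 2^{g−1}` under the same hypotheses. [cite: Serre1977, §2.6 Thm. 8 (ii) and §5.1] -/
theorem finrank_eigenspace_neg_one_eq_of_traces {T : Module.End ℂ (GForm E ℂ)} (hT : T ^ 4 = 1)
    (h1 : LinearMap.trace ℂ (GForm E ℂ) T = (2 : ℂ) ^ finrank ℂ E) (h2 : LinearMap.trace ℂ (GForm E ℂ) (T ^ 2) = 0)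
    (h3 : LinearMap.trace ℂ (GForm E ℂ) (T ^ 3) = (2 : ℂ) ^ finrank ℂ E) :
    finrank ℂ ↥(Module.End.eigenspace T (-1)) = 4 ^ (finrank ℂ E - 1) - 2 ^ (finrank ℂ E - 1) := by
  have h := four_mul_finrank_eigenspace_eq_of_traces hT h1 h2 h3 (μ := -1) (by norm_num)
  obtain ⟨h4, h2'⟩ := four_pow_finrank₉₄ (E := E)
  have hle : 2 ^ (finrank ℂ E - 1) ≤ 4 ^ (finrank ℂ E - 1) := Nat.pow_le_pow_left (by norm_num) _
  rw [inv_neg, inv_one, show ((-1 : ℂ) + (-1) ^ 3) * 2 ^ finrank ℂ E = -(2 ^ finrank ℂ E + 2 ^ finrank ℂ E) by ring, h4, h2',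
    ← sub_eq_add_neg, ← mul_sub] at h
  have h' := mul_left_cancel₀ (by norm_num : (4 : ℂ) ≠ 0) h
  have h'' : (finrank ℂ ↥(Module.End.eigenspace T (-1)) : ℂ) = ((4 ^ (finrank ℂ E - 1) - 2 ^ (finrank ℂ E - 1) : ℕ) : ℂ) := by
    rw [h', Nat.cast_sub hle]; push_cast; ring
  exact_mod_cast h''

/-- `dim ker(T − i) = 4^{g−1}` under the same hypotheses (`i⁻¹ + i^{−3} = 0`). [cite: Serre1977, §2.6 Thm. 8 (ii) and §5.1] -/
theorem finrank_eigenspace_I_eq_of_traces {T : Module.End ℂ (GForm E ℂ)} (hT : T ^ 4 = 1)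
    (h1 : LinearMap.trace ℂ (GForm E ℂ) T = (2 : ℂ) ^ finrank ℂ E) (h2 : LinearMap.trace ℂ (GForm E ℂ) (T ^ 2) = 0)
    (h3 : LinearMap.trace ℂ (GForm E ℂ) (T ^ 3) = (2 : ℂ) ^ finrank ℂ E) :
    finrank ℂ ↥(Module.End.eigenspace T I) = 4 ^ (finrank ℂ E - 1) := by
  have h := four_mul_finrank_eigenspace_eq_of_traces hT h1 h2 h3 (μ := I) Complex.I_pow_four
  obtain ⟨h4, -⟩ := four_pow_finrank₉₄ (E := E)
  rw [Complex.inv_I, show ((-I : ℂ) + (-I) ^ 3) = 0 by rw [neg_pow, Complex.I_pow_three]; ring, zero_mul, add_zero, h4] at h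
  exact_mod_cast mul_left_cancel₀ (by norm_num : (4 : ℂ) ≠ 0) h

/-- `dim ker(T + i) = 4^{g−1}` under the same hypotheses. [cite: Serre1977, §2.6 Thm. 8 (ii) and §5.1] -/
theorem finrank_eigenspace_neg_I_eq_of_traces {T : Module.End ℂ (GForm E ℂ)} (hT : T ^ 4 = 1)
    (h1 : LinearMap.trace ℂ (GForm E ℂ) T = (2 : ℂ) ^ finrank ℂ E) (h2 : LinearMap.trace ℂ (GForm E ℂ) (T ^ 2) = 0)
    (h3 : LinearMap.trace ℂ (GForm E ℂ) (T ^ 3) = (2 : ℂ) ^ finrank ℂ E) :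
    finrank ℂ ↥(Module.End.eigenspace T (-I)) = 4 ^ (finrank ℂ E - 1) := by
  have h := four_mul_finrank_eigenspace_eq_of_traces hT h1 h2 h3 (μ := -I) (by rw [neg_pow, Complex.I_pow_four]; norm_num)
  obtain ⟨h4, -⟩ := four_pow_finrank₉₄ (E := E)
  rw [inv_neg, Complex.inv_I, neg_neg, show ((I : ℂ) + I ^ 3) = 0 by rw [Complex.I_pow_three]; ring, zero_mul, add_zero, h4] at h
  exact_mod_cast mul_left_cancel₀ (by norm_num : (4 : ℂ) ≠ 0) h

/-! ## §1 The spectrum of the Weyl operator `w` -/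

section Weyl

/-- **`4 · dim ker(w − μ) = 4^g + (μ⁻¹ + μ^{−3}) 2^g`** for `μ⁴ = 1`. [cite: Serre1977, §2.6 Thm. 8 (ii) and §5.1] [cite: Beauville2010SL2, §3 Proposition (ii)] -/
theorem four_mul_finrank_eigenspace_weylOperator_eq (hη : ∀ v : E, v ≠ 0 → ∃ w : E, η ![v, w] ≠ 0) {μ : ℂ} (hμ : μ ^ 4 = 1) :
    (4 : ℂ) * (finrank ℂ ↥(Module.End.eigenspace ((hasLefschetzProperty_lefschetzG hη).weylOperator isZGrading_countingG) μ) : ℂ) =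
      4 ^ finrank ℂ E + (μ⁻¹ + μ⁻¹ ^ 3) * 2 ^ finrank ℂ E :=
  four_mul_finrank_eigenspace_eq_of_traces ((hasLefschetzProperty_lefschetzG hη).weylOperator_pow_four isZGrading_countingG)
    (trace_weylOperator hη) (trace_weylOperator_sq hη) (trace_weylOperator_pow_three hη) hμ

/-- **`dim ker(w − 1) = 4^{g−1} + 2^{g−1}`**: the multiplicity of the eigenvalue `1` of the Weyl operator on `H•(X; ℂ)`.
[cite: Serre1977, §2.6 Thm. 8 (ii), Ex. 2.8 (a) and §5.1] [cite: Beauville2010SL2, §3 Proposition (ii) and §4 Theorem] -/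
theorem finrank_eigenspace_weylOperator_one (hη : ∀ v : E, v ≠ 0 → ∃ w : E, η ![v, w] ≠ 0) :
    finrank ℂ ↥(Module.End.eigenspace ((hasLefschetzProperty_lefschetzG hη).weylOperator isZGrading_countingG) 1) =
      4 ^ (finrank ℂ E - 1) + 2 ^ (finrank ℂ E - 1) :=
  finrank_eigenspace_one_eq_of_traces ((hasLefschetzProperty_lefschetzG hη).weylOperator_pow_four isZGrading_countingG)
    (trace_weylOperator hη) (trace_weylOperator_sq hη) (trace_weylOperator_pow_three hη)

/-- **`dim ker(w + 1) = 4^{g−1} − 2^{g−1}`**: the multiplicity of the eigenvalue `−1` of the Weyl operator.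
[cite: Serre1977, §2.6 Thm. 8 (ii), Ex. 2.8 (a) and §5.1] [cite: Beauville2010SL2, §3 Proposition (ii) and §4 Theorem] -/
theorem finrank_eigenspace_weylOperator_neg_one (hη : ∀ v : E, v ≠ 0 → ∃ w : E, η ![v, w] ≠ 0) :
    finrank ℂ ↥(Module.End.eigenspace ((hasLefschetzProperty_lefschetzG hη).weylOperator isZGrading_countingG) (-1)) =
      4 ^ (finrank ℂ E - 1) - 2 ^ (finrank ℂ E - 1) :=
  finrank_eigenspace_neg_one_eq_of_traces ((hasLefschetzProperty_lefschetzG hη).weylOperator_pow_four isZGrading_countingG)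
    (trace_weylOperator hη) (trace_weylOperator_sq hη) (trace_weylOperator_pow_three hη)

/-- **`dim ker(w − i) = 4^{g−1}`**: the multiplicity of the eigenvalue `i` of the Weyl operator.
[cite: Serre1977, §2.6 Thm. 8 (ii), Ex. 2.8 (a) and §5.1] [cite: Beauville2010SL2, §3 Proposition (ii) and §4 Theorem] -/
theorem finrank_eigenspace_weylOperator_I (hη : ∀ v : E, v ≠ 0 → ∃ w : E, η ![v, w] ≠ 0) :
    finrank ℂ ↥(Module.End.eigenspace ((hasLefschetzProperty_lefschetzG hη).weylOperator isZGrading_countingG) I) =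
      4 ^ (finrank ℂ E - 1) :=
  finrank_eigenspace_I_eq_of_traces ((hasLefschetzProperty_lefschetzG hη).weylOperator_pow_four isZGrading_countingG)
    (trace_weylOperator hη) (trace_weylOperator_sq hη) (trace_weylOperator_pow_three hη)

/-- **`dim ker(w + i) = 4^{g−1}`**: the multiplicity of the eigenvalue `−i` of the Weyl operator.
[cite: Serre1977, §2.6 Thm. 8 (ii), Ex. 2.8 (a) and §5.1] [cite: Beauville2010SL2, §3 Proposition (ii) and §4 Theorem] -/
theorem finrank_eigenspace_weylOperator_neg_I (hη : ∀ v : E, v ≠ 0 → ∃ w : E, η ![v, w] ≠ 0) :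
    finrank ℂ ↥(Module.End.eigenspace ((hasLefschetzProperty_lefschetzG hη).weylOperator isZGrading_countingG) (-I)) =
      4 ^ (finrank ℂ E - 1) :=
  finrank_eigenspace_neg_I_eq_of_traces ((hasLefschetzProperty_lefschetzG hη).weylOperator_pow_four isZGrading_countingG)
    (trace_weylOperator hη) (trace_weylOperator_sq hη) (trace_weylOperator_pow_three hη)

/-- **`w` is diagonalizable: `⨆_{j<4} ker(w − i^j) = H•(X; ℂ)`.** [cite: Serre1977, §2.6 Thm. 8 (i) and §5.1] [cite: Beauville2010SL2, §3 Proposition (ii)] -/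
theorem iSup_eigenspace_weylOperator_eq_top (hη : ∀ v : E, v ≠ 0 → ∃ w : E, η ![v, w] ≠ 0) :
    ⨆ j : Fin 4, Module.End.eigenspace ((hasLefschetzProperty_lefschetzG hη).weylOperator isZGrading_countingG) (I ^ (j : ℕ)) = ⊤ :=
  iSup_eigenspace_pow_eq_top _ four_ne_zero₉₄ ((hasLefschetzProperty_lefschetzG hη).weylOperator_pow_four isZGrading_countingG)
    isPrimitiveRoot_I_four₉₄

/-- **`H•(X; ℂ) = ker(w − 1) ⊕ ker(w − i) ⊕ ker(w + 1) ⊕ ker(w + i)`** (internal direct sum over `j ∈ Fin 4`, eigenvalue `i^j`).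
[cite: Serre1977, §2.6 Thm. 8 (i) and §5.1] [cite: Beauville2010SL2, §3 Proposition (ii)] -/
theorem isInternal_eigenspace_weylOperator (hη : ∀ v : E, v ≠ 0 → ∃ w : E, η ![v, w] ≠ 0) :
    DirectSum.IsInternal fun j : Fin 4 ↦
      Module.End.eigenspace ((hasLefschetzProperty_lefschetzG hη).weylOperator isZGrading_countingG) (I ^ (j : ℕ)) :=
  isInternal_eigenspace_pow _ four_ne_zero₉₄ ((hasLefschetzProperty_lefschetzG hη).weylOperator_pow_four isZGrading_countingG)
    isPrimitiveRoot_I_four₉₄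

end Weyl

/-! ## §2 The spectrum of the Weil operator `C = (i·)^*` (no polarisation needed) -/

section Weil

/-- **`4 · dim ker(C − μ) = 4^g + (μ⁻¹ + μ^{−3}) 2^g`** for `μ⁴ = 1`. [cite: Serre1977, §2.6 Thm. 8 (ii) and §5.1] [cite: Deligne1982HodgeCycles, I Prop. 3.6 (proof)] -/
theorem four_mul_finrank_eigenspace_rotG_pi_div_two_eq {μ : ℂ} (hμ : μ ^ 4 = 1) :
    (4 : ℂ) * (finrank ℂ ↥(Module.End.eigenspace (rotG E (π / 2)) μ) : ℂ) = 4 ^ finrank ℂ E + (μ⁻¹ + μ⁻¹ ^ 3) * 2 ^ finrank ℂ E :=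
  four_mul_finrank_eigenspace_eq_of_traces rotG_pi_div_two_pow_four trace_rotG_pi_div_two trace_rotG_pi_div_two_sq
    trace_rotG_pi_div_two_pow_three hμ

/-- **`dim ker(C − 1) = 4^{g−1} + 2^{g−1}`** (`= Σ_{p ≡ q (4)} h^{p,q}`). [cite: Serre1977, §2.6 Thm. 8 (ii) and §5.1]
[cite: Deligne1982HodgeCycles, I Prop. 3.6 (proof)] [cite: Lange2023AbelianVarietiesComplex, §1.1.5 Prop. 1.1.23] -/
theorem finrank_eigenspace_rotG_pi_div_two_one :
    finrank ℂ ↥(Module.End.eigenspace (rotG E (π / 2)) 1) = 4 ^ (finrank ℂ E - 1) + 2 ^ (finrank ℂ E - 1) :=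
  finrank_eigenspace_one_eq_of_traces rotG_pi_div_two_pow_four trace_rotG_pi_div_two trace_rotG_pi_div_two_sq
    trace_rotG_pi_div_two_pow_three

/-- **`dim ker(C + 1) = 4^{g−1} − 2^{g−1}`** (`= Σ_{p − q ≡ 2 (4)} h^{p,q}`). [cite: Serre1977, §2.6 Thm. 8 (ii) and §5.1]
[cite: Deligne1982HodgeCycles, I Prop. 3.6 (proof)] [cite: Lange2023AbelianVarietiesComplex, §1.1.5 Prop. 1.1.23] -/
theorem finrank_eigenspace_rotG_pi_div_two_neg_one :
    finrank ℂ ↥(Module.End.eigenspace (rotG E (π / 2)) (-1)) = 4 ^ (finrank ℂ E - 1) - 2 ^ (finrank ℂ E - 1) :=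
  finrank_eigenspace_neg_one_eq_of_traces rotG_pi_div_two_pow_four trace_rotG_pi_div_two trace_rotG_pi_div_two_sq
    trace_rotG_pi_div_two_pow_three

/-- **`dim ker(C − i) = 4^{g−1}`** (`= Σ_{p − q ≡ 1 (4)} h^{p,q}`). [cite: Serre1977, §2.6 Thm. 8 (ii) and §5.1] [cite: Deligne1982HodgeCycles, I Prop. 3.6 (proof)]
[cite: Lange2023AbelianVarietiesComplex, §1.1.5 Prop. 1.1.23] -/
theorem finrank_eigenspace_rotG_pi_div_two_I :
    finrank ℂ ↥(Module.End.eigenspace (rotG E (π / 2)) I) = 4 ^ (finrank ℂ E - 1) :=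
  finrank_eigenspace_I_eq_of_traces rotG_pi_div_two_pow_four trace_rotG_pi_div_two trace_rotG_pi_div_two_sq
    trace_rotG_pi_div_two_pow_three

/-- **`dim ker(C + i) = 4^{g−1}`** (`= Σ_{p − q ≡ 3 (4)} h^{p,q}`). [cite: Serre1977, §2.6 Thm. 8 (ii) and §5.1] [cite: Deligne1982HodgeCycles, I Prop. 3.6 (proof)]
[cite: Lange2023AbelianVarietiesComplex, §1.1.5 Prop. 1.1.23] -/
theorem finrank_eigenspace_rotG_pi_div_two_neg_I :
    finrank ℂ ↥(Module.End.eigenspace (rotG E (π / 2)) (-I)) = 4 ^ (finrank ℂ E - 1) :=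
  finrank_eigenspace_neg_I_eq_of_traces rotG_pi_div_two_pow_four trace_rotG_pi_div_two trace_rotG_pi_div_two_sq
    trace_rotG_pi_div_two_pow_three

omit [FiniteDimensional ℂ E] [Nontrivial E] in
/-- **`C` is diagonalizable: `⨆_{j<4} ker(C − i^j) = H•(X; ℂ)`.** [cite: Serre1977, §2.6 Thm. 8 (i) and §5.1] [cite: Deligne1982HodgeCycles, I Prop. 3.6 (proof)] -/
theorem iSup_eigenspace_rotG_pi_div_two_eq_top :
    ⨆ j : Fin 4, Module.End.eigenspace (rotG E (π / 2)) (I ^ (j : ℕ)) = ⊤ :=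
  iSup_eigenspace_pow_eq_top _ four_ne_zero₉₄ rotG_pi_div_two_pow_four isPrimitiveRoot_I_four₉₄

omit [FiniteDimensional ℂ E] [Nontrivial E] in
/-- **`H•(X; ℂ) = ker(C − 1) ⊕ ker(C − i) ⊕ ker(C + 1) ⊕ ker(C + i)`** (`ker(C − i^j) = ⊕_{p−q ≡ j (4)} H^{p,q}`).
[cite: Serre1977, §2.6 Thm. 8 (i) and §5.1] [cite: Deligne1982HodgeCycles, I Prop. 3.6 (proof)] -/
theorem isInternal_eigenspace_rotG_pi_div_two :
    DirectSum.IsInternal fun j : Fin 4 ↦ Module.End.eigenspace (rotG E (π / 2)) (I ^ (j : ℕ)) :=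
  isInternal_eigenspace_pow _ four_ne_zero₉₄ rotG_pi_div_two_pow_four isPrimitiveRoot_I_four₉₄

/-- **`dim ker(w − μ) = dim ker(C − μ)` at every fourth root of unity `μ`**: the Weyl operator of any Lefschetz `SL₂` and the Weil
operator of the complex structure have the same spectrum on `H•(X; ℂ)`. [cite: Serre1977, §2.6 Thm. 8 (ii) and §5.1]
[cite: Deligne1982HodgeCycles, I Prop. 3.6 (proof)] [cite: Beauville2010SL2, §3 Proposition (ii)] -/
theorem finrank_eigenspace_weylOperator_eq_finrank_eigenspace_rotG_pi_div_two (hη : ∀ v : E, v ≠ 0 → ∃ w : E, η ![v, w] ≠ 0) {μ : ℂ}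
    (hμ : μ ^ 4 = 1) :
    finrank ℂ ↥(Module.End.eigenspace ((hasLefschetzProperty_lefschetzG hη).weylOperator isZGrading_countingG) μ) =
      finrank ℂ ↥(Module.End.eigenspace (rotG E (π / 2)) μ) := by
  have h := (four_mul_finrank_eigenspace_weylOperator_eq hη hμ).trans (four_mul_finrank_eigenspace_rotG_pi_div_two_eq hμ).symm
  exact_mod_cast mul_left_cancel₀ (by norm_num : (4 : ℂ) ≠ 0) h

end Weil

end ComplexTorus

end Literature.Geometry.Kaehler

end
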